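import Summits.HodgeConjecture.HodgeConjecture.Theorems.VHCAbelianSchemesRoadWeilLineAnchors
import Literature.AlgebraicGeometry.Andre1996.WeilLineTensorPencilsPrescribedFibre
import Literature.AlgebraicGeometry.HodgeTheory.AbelianThreefoldsStablyNondegenerate
import HarnessLib

/-!
# Road b02 (`VHCAbelianSchemesRoad`) × the André column — THE LINE ENGINE OVER A PRESCRIBED SPECIAL FIBRE: one carried `E`-Weil class per tensor structure
# on the abelian varieties isogenous to powers of an abelian variety `Y₀` OF OUR CHOICE with `dim Y₀ ∣ p` (route-free)

research route, not a corollary; conditional on HC_CM plus one named minimal statement.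

ROUTE-FREE (no `Theses.*` import). PART AE-II of the André column. The proof of André's Lemme 6.3.3 (p. 33) builds its compact pencil from an ARBITRARY
polarised weight-one `ℚ`-Hodge structure `V₀` of rank `2p` («par exemple le H¹ d'une puissance p-ième d'une courbe elliptique»), and uses the elliptic power only
through «tout cycle de Hodge sur [la fibre spéciale] est algébrique». The Literature facts `andre1996_splitWeilClasses_weilLinePencil_over` /
`andre1996_cmHodgeClasses_weilLinePencils_over` (statement only) record this: special fibre isogenous to a power of a PRESCRIBED `Y₀` (`0 < dim Y₀ ∣ p`), with
the algebraicity of Hodge classes on the varieties isogenous to powers of `Y₀` as a hypothesis on `Y₀` — a THEOREM of the tree for `dim Y₀ ≤ 3`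
(`isStablyNondegenerate_of_dim_pos_of_dim_le_three`, Moonen–Zarhin Thm. 0.1 (4), with `IsStablyNondegenerate.hodgeConjectureFor_of_isIsogenous_powSucc`). Since
the LINE ENGINE of `VHCAbelianSchemesRoadWeilLineAnchors` (§2 there) is parametric in the anchor variety, everything of its §3 goes through with `Y₀` in the slot
of `E₀`:

* §1 the prescribed-fibre facts SPECIALISE to the elliptic ones (`Y₀ := E₀`, `1 ∣ p`, Hodge classes on elliptic powers algebraic in the tree):
  `andre1996_splitWeilClasses_weilLinePencil_of_over`, `andre1996_cmHodgeClasses_weilLinePencils_of_over`;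
* §2 split `E`-Weil classes in codimension `p` from the door ∧ the split fact over `Y₀` ∧ `OneTensorWeilHodgeClassCarriersAt 𝒪 Y₀ (dim B) p` for ONE `Y₀` with
  `dim Y₀ ∣ p` (general `Y₀` under the algebraicity hypothesis; `dim Y₀ ≤ 3` unconditionally): at `(6,3)` with `Y₀` a generic genus-3 Jacobian the tensor point
  `J(C) ⊗ 𝒪_K` is exactly the anchor of Markman's semiregular secant sheaves (arXiv:2502.03415) — the carrier input of that cell is in print modulo the door's
  format; at `(8,2)` any abelian surface may serve;
* §3 `HC_CM` and `HC_AV` (with `HC_CM` idle) from a FAMILY of anchors `Y : ℕ → AbelianVariety ℂ`, one per codimension `p` (`0 < dim (Y p) ∣ p`), and the per-cell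
  guarded node over `Y p` — the André column's `B_min` with the elliptic curve replaced by anchor varieties of our choice (recovering gen 61's rows at `Y p := E₀`).

HONEST: every carrier node is OPEN, not in print, NOT implied by the Hodge conjecture; the prescribed-fibre facts are faithful to André's PROOF (not to the
printed statement (ii) of the Lemma, which names the elliptic example) and enter BY NAME; PART AE's no-go (evidence n°50/57 on the crux item: no split ∕
semi-homogeneous ∕ abelian-subvariety-union carriers at Weil-type points) says the carried object must be indecomposable with Chern character in the generic
Hodge ring — Markman's objects are. Nothing here says any carrier, door, Weil class, `HC_CM`, `HC_AV` or HC holds.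
References: [cite: Andre1996Motifs, §6.3 a)–c), Lemmes 6.3.1–6.3.3 and proof of 6.3.3 (pp. 31–33)] [cite: MoonenZarhin1999LowDim, Thm. 0.1 (4)]
[cite: MoonenZarhin1998WeilClasses, §1] [cite: Markman2025SecantWeil, §1 Thm. 1] [cite: Markman2025SecantRealMultiplication, §1.1]
[cite: Bloch1972Semiregularity, Remark (7.5)] [cite: BuchweitzFlenner2003, Prop. 4.2, Prop. 4.4 and §5 Thm. 5.1] [cite: Milne1999, §7 p. 72].
-/

noncomputable section

open CategoryTheory CategoryTheory.Limits AlgebraicGeometry Topology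

namespace Summit.HodgeConjecture.HodgeConjecture.Ring2.SemiregularRepresentatives

-- the cell's namespace repeats the summit name (`Summit.HodgeConjecture.HodgeConjecture…`), as in every `Ring2*` file
set_option linter.dupNamespace false

open Literature.AlgebraicGeometry Literature.AlgebraicGeometry.Motives
open Literature.AlgebraicGeometry.HodgeTheory
open Literature.AlgebraicGeometry.Deligne1982
open Literature.AlgebraicGeometry.VanGeemen1994 (pullbackOne)
open Literature.AlgebraicTopology.SingularHomology
open Literature.AlgebraicGeometry.Andre1996 (andre1996_splitWeilClasses_weilLinePencil andre1996_cmHodgeClasses_weilLinePencils andre1996_cmAnchoredPencil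
  andre1996_splitWeilClasses_weilLinePencil_over andre1996_cmHodgeClasses_weilLinePencils_over IsWeilLineAnchoredPencilFor)
open Literature.AlgebraicGeometry.Milne1999 (IsOfCMType CMHodgeHypothesisAt)
open Summit.Ventures.HSemireg (ObjClass LocalVariationalHodgeFor)
open Summit.HodgeConjecture.HodgeConjecture.Ring2.AbelianAll (carriedClasses OneTensorWeilHodgeClassCarriers OneTensorWeilHodgeClassCarriersAt)

/-! ## §0 The algebraicity input for the prescribed special fibre -/

/-- **André's input (iii) for a prescribed `Y₀` of dimension `≤ 3` is a theorem of the tree**: every Hodge class on every complex abelian variety isogenous to a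
power of an abelian variety of dimension `1`, `2` or `3` is algebraic (Moonen–Zarhin: such varieties are stably non-degenerate; Lefschetz `(1,1)` and products).
UNCONDITIONAL. [cite: MoonenZarhin1999LowDim, Thm. 0.1 (4) and §2 (2.2)] [cite: vanGeemen1994HodgeAV, Lemma 3.7] -/
theorem hodgeConjectureFor_of_isIsogenous_powSucc_of_dim_le_three {Y₀ : AbelianVariety ℂ} (h0 : 0 < Y₀.dim) (h3 : Y₀.dim ≤ 3)
    (X : AbelianVariety ℂ) (N : ℕ) (hX : X.IsIsogenous (Y₀.powSucc N)) : HodgeConjectureFor X.dim X.X :=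
  (isStablyNondegenerate_of_dim_pos_of_dim_le_three h0 h3).hodgeConjectureFor_of_isIsogenous_powSucc hX

/-! ## §1 The prescribed-fibre facts specialise to the elliptic ones -/

/-- `andre1996_splitWeilClasses_weilLinePencil_over ⟹ andre1996_splitWeilClasses_weilLinePencil` (`Y₀ := E₀`, `dim E₀ = 1 ∣ p`, Hodge classes on elliptic
powers algebraic in the tree). [cite: Andre1996Motifs, Lemme 6.3.3 and proof (p. 33)] [cite: MoonenZarhin1999LowDim, Thm. 0.1 (4)] -/
theorem andre1996_splitWeilClasses_weilLinePencil_of_over (h : andre1996_splitWeilClasses_weilLinePencil_over) :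
    andre1996_splitWeilClasses_weilLinePencil := by
  intro E₀ hE₀ R e₀ p hp n B η e a w hB ha hRos hsplit hw hwQ
  exact h E₀ (by omega) (hodgeConjectureFor_of_isIsogenous_powSucc_of_dim_le_three (by omega) (by omega)) R e₀ p hp
    (by rw [hE₀]; exact one_dvd p) n B η e a w hB ha hRos hsplit hw hwQ

/-- `andre1996_cmHodgeClasses_weilLinePencils_over ⟹ andre1996_cmHodgeClasses_weilLinePencils` (`Y₀ := E₀`).
[cite: Andre1996Motifs, Lemmes 6.3.2–6.3.3 and proof (pp. 32–33)] [cite: MoonenZarhin1999LowDim, Thm. 0.1 (4)] -/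
theorem andre1996_cmHodgeClasses_weilLinePencils_of_over (h : andre1996_cmHodgeClasses_weilLinePencils_over) :
    andre1996_cmHodgeClasses_weilLinePencils := by
  intro E₀ hE₀ B hB hCM p hp c hc hpp
  exact h E₀ (by omega) (hodgeConjectureFor_of_isIsogenous_powSucc_of_dim_le_three (by omega) (by omega)) B hB hCM p hp
    (by rw [hE₀]; exact one_dvd p) c hc hpp

/-! ## §2 Split `E`-Weil classes in codimension `p` from ONE carried class per tensor structure over a prescribed `Y₀` with `dim Y₀ ∣ p` -/

section FromNodeOver

variable {𝒪 : ObjClass} {p : ℕ} {B : AbelianVariety ℂ} {η : B ⟶ B} {R : Polynomial ℤ} {e₀ : ℕ}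
  {e : ProjectiveEmbedding B.X} {a : complexBetti (projectiveSpace e.n ℂ) 2} {w : complexBetti B.X (2 * p)}

/-- Mid-range bookkeeping: `p + 2 ≤ dim B = 2p·e₀` for `p ≥ 2`. [folklore] -/
private theorem two_le_dim_of_isWeilTypeCM' (hB : IsWeilTypeCM B η R e₀ p) (hp : 2 ≤ p) : p + 2 ≤ B.dim := by
  have h1 : 2 * p * 1 ≤ 2 * p * e₀ := Nat.mul_le_mul_left _ hB.e₀_pos
  rw [hB.dim_eq]
  omega

/-- **SPLIT `E`-WEIL CLASSES IN CODIMENSION `p`, FROM ONE CARRIED CLASS PER TENSOR STRUCTURE OVER A PRESCRIBED `Y₀` (`0 < dim Y₀ ∣ p`; Hodge classes on the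
varieties isogenous to powers of `Y₀` algebraic)**: the prescribed-fibre split LINE fact ∧ the door for `𝒪` ∧ the GUARDED one-class statement at the cell
`(dim B, p)` over `Y₀` ⟹ every rational Weil class of every split `E`-Weil datum of codimension `p` is algebraic (`p = 1`: Lefschetz; `p ≥ 2`: `w = 0` trivially,
else the LINE engine on the fact's pencil). NO CM hypothesis on `B`; `HC_CM` absent. [cite: Andre1996Motifs, §6.3 a)–c) and proof of Lemme 6.3.3 (pp. 32–33)]
[cite: MoonenZarhin1998WeilClasses, §1] [cite: Markman2025SurveySecant, §4] [cite: Bloch1972Semiregularity, Remark (7.5)] -/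
theorem splitWeilClass_mem_algebraicClasses_of_weilLinePencilOver_of_door_of_oneTensorWeilHodgeClassCarriersAt
    (h : andre1996_splitWeilClasses_weilLinePencil_over) (hT : LocalVariationalHodgeFor 𝒪) {Y₀ : AbelianVariety ℂ} (hY₀ : 0 < Y₀.dim) (hdvd : Y₀.dim ∣ p)
    (hHC : ∀ (X : AbelianVariety ℂ) (N : ℕ), X.IsIsogenous (Y₀.powSucc N) → HodgeConjectureFor X.dim X.X)
    (hone : OneTensorWeilHodgeClassCarriersAt 𝒪 Y₀ B.dim p) (hB : IsWeilTypeCM B η R e₀ p) (ha : IsRationalClass a) (ha₀ : a ≠ 0)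
    (hRos : ∀ x y : complexBetti B.X 1,
      polarizationPairingOne B.X (complexBetti.map e.ι 2 a) (B.dim - 1) (pullbackOne B η x) y =
        -polarizationPairingOne B.X (complexBetti.map e.ι 2 a) (B.dim - 1) x (pullbackOne B η y))
    (hsplit : IsHyperbolicWeilType B η (p * e₀) (complexBetti.map e.ι 2 a))
    (hw : w ∈ weilClassesField B η (R.comp (Polynomial.X ^ 2)) (2 * p)) (hwQ : IsRationalClass w) :
    w ∈ algebraicClasses B.X p := by
  obtain _ | _ | p := p
  · exact absurd hB.k_pos (lt_irrefl 0)
  · exact lefschetzOneOne_rational_holds hB.isSmoothProjective w hwQ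
      (hB.isOfHodgeType_of_mem_weilClassesField MoonenZarhin1998_weilClasses_hodgeCriterion_holds hw)
  · by_cases hw0 : w = 0
    · rw [hw0]; exact zero_mem _
    obtain ⟨𝒳, S, f, hf⟩ := h Y₀ hY₀ hHC R e₀ (p + 2) (by omega) hdvd 1 (fun _ => B) (fun _ => η) (fun _ => e) (fun _ => a)
      (fun _ => w) (fun _ => hB) (fun _ => ⟨ha, ha₀⟩) (fun _ => hRos) (fun _ => hsplit) (fun _ => hw) (fun _ => hwQ)
    exact weilClassesField_le_algebraicClasses_of_isWeilLineAnchoredPencilFor_of_door_of_oneCarried hT hB hw0 (hf 0)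
      (fun X θ hθ A₀ e' N ψ₀ hd hiso ↦ hone X θ hθ A₀ e' N ψ₀ hd hiso) hw

/-- **The whole line over a prescribed `Y₀`**: `W_E(B) ⊗ ℂ ≤ algebraicClasses B.X p` for every split datum of codimension `p`, `dim Y₀ ∣ p`.
[cite: MoonenZarhin1998WeilClasses, §1 Lemma (1)] [cite: Andre1996Motifs, §6.3 c) and proof of Lemme 6.3.3 (p. 33)] -/
theorem weilClassesField_le_algebraicClasses_of_split_of_weilLinePencilOver_of_door_of_oneTensorWeilHodgeClassCarriersAt
    (h : andre1996_splitWeilClasses_weilLinePencil_over) (hT : LocalVariationalHodgeFor 𝒪) {Y₀ : AbelianVariety ℂ} (hY₀ : 0 < Y₀.dim) (hdvd : Y₀.dim ∣ p)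
    (hHC : ∀ (X : AbelianVariety ℂ) (N : ℕ), X.IsIsogenous (Y₀.powSucc N) → HodgeConjectureFor X.dim X.X)
    (hone : OneTensorWeilHodgeClassCarriersAt 𝒪 Y₀ B.dim p) (hB : IsWeilTypeCM B η R e₀ p) (ha : IsRationalClass a) (ha₀ : a ≠ 0)
    (hRos : ∀ x y : complexBetti B.X 1,
      polarizationPairingOne B.X (complexBetti.map e.ι 2 a) (B.dim - 1) (pullbackOne B η x) y =
        -polarizationPairingOne B.X (complexBetti.map e.ι 2 a) (B.dim - 1) x (pullbackOne B η y))
    (hsplit : IsHyperbolicWeilType B η (p * e₀) (complexBetti.map e.ι 2 a)) :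
    weilClassesField B η (R.comp (Polynomial.X ^ 2)) (2 * p) ≤ algebraicClasses B.X p :=
  hB.weilClassesField_le_algebraicClasses_of_forall_isRationalClass fun _ hc hcQ ↦
    splitWeilClass_mem_algebraicClasses_of_weilLinePencilOver_of_door_of_oneTensorWeilHodgeClassCarriersAt h hT hY₀ hdvd hHC hone hB ha ha₀ hRos hsplit
      hc hcQ

/-- **UNCONDITIONAL SUPPLY OF THE ANCHOR: `dim Y₀ ≤ 3`.** The door ∧ the prescribed-fibre split fact ∧ the guarded one-class statement at `(dim B, p)` over ANY `Y₀`
with `0 < dim Y₀ ≤ 3` and `dim Y₀ ∣ p` ⟹ `W_E(B) ⊗ ℂ ≤ algebraicClasses B.X p`. At `p = 3`, `[E:ℚ] = 2`: `Y₀` = a generic genus-3 Jacobian puts the special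
fibre at Markman's anchor `J(C) ⊗ 𝒪_K`; at `p = 2`: any abelian surface. [cite: MoonenZarhin1999LowDim, Thm. 0.1 (4)] [cite: Markman2025SecantWeil, §1 Thm. 1]
[cite: Andre1996Motifs, proof of Lemme 6.3.3 (p. 33)] -/
theorem weilClassesField_le_algebraicClasses_of_split_of_weilLinePencilOver_of_door_of_oneTensorWeilHodgeClassCarriersAt_of_dim_le_three
    (h : andre1996_splitWeilClasses_weilLinePencil_over) (hT : LocalVariationalHodgeFor 𝒪) {Y₀ : AbelianVariety ℂ} (hY₀ : 0 < Y₀.dim) (h3 : Y₀.dim ≤ 3)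
    (hdvd : Y₀.dim ∣ p) (hone : OneTensorWeilHodgeClassCarriersAt 𝒪 Y₀ B.dim p) (hB : IsWeilTypeCM B η R e₀ p) (ha : IsRationalClass a) (ha₀ : a ≠ 0)
    (hRos : ∀ x y : complexBetti B.X 1,
      polarizationPairingOne B.X (complexBetti.map e.ι 2 a) (B.dim - 1) (pullbackOne B η x) y =
        -polarizationPairingOne B.X (complexBetti.map e.ι 2 a) (B.dim - 1) x (pullbackOne B η y))
    (hsplit : IsHyperbolicWeilType B η (p * e₀) (complexBetti.map e.ι 2 a)) :
    weilClassesField B η (R.comp (Polynomial.X ^ 2)) (2 * p) ≤ algebraicClasses B.X p :=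
  weilClassesField_le_algebraicClasses_of_split_of_weilLinePencilOver_of_door_of_oneTensorWeilHodgeClassCarriersAt h hT hY₀ hdvd
    (hodgeConjectureFor_of_isIsogenous_powSucc_of_dim_le_three hY₀ h3) hone hB ha ha₀ hRos hsplit

/-- Lattice: the all-cells guarded node over `Y₀` gives the per-cell statement in the mid range. [cite: Bloch1972Semiregularity, Remark (7.5)] -/
theorem oneTensorWeilHodgeClassCarriersAt_of_oneTensorWeilHodgeClassCarriers {Y₀ : AbelianVariety ℂ} (h : OneTensorWeilHodgeClassCarriers 𝒪 Y₀) {n : ℕ}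
    (hp : 2 ≤ p) (hn : p + 2 ≤ n) : OneTensorWeilHodgeClassCarriersAt 𝒪 Y₀ n p :=
  fun X θ hθ A₀ e' N ψ₀ hd hiso ↦ h n p hp hn X θ hθ A₀ e' N ψ₀ hd hiso

end FromNodeOver

/-! ## §3 `HC_CM` and `HC_AV` from a family of anchors `Y : ℕ → AbelianVariety ℂ`, one per codimension -/

section Family

variable {𝒪 : ObjClass}

/-- **`HC_CM` FROM ONE CARRIED CLASS PER TENSOR STRUCTURE OVER A FAMILY OF PRESCRIBED ANCHORS**: the prescribed-fibre CM LINE fact ∧ the door for `𝒪` ∧ for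
every codimension `p` an anchor `Y p` with `0 < dim (Y p) ∣ p` whose powers satisfy the Hodge conjecture ∧ the guarded per-cell node over `Y p` at every cell
`(n, p)`, `2 ≤ p ≤ n − 2` ⟹ `CMHodgeHypothesisAt B` for every `B` (codimension `≤ 1` Lefschetz; `p ≥ 2`: each generator `g^*(w)` has `w` in the `E'`-line,
algebraic by the LINE engine or `0`). [cite: Andre1996Motifs, §6.3 Lemmes 6.3.2–6.3.3 and proof (pp. 32–33)] [cite: MoonenZarhin1998WeilClasses, §1]
[cite: Milne1999, §7 p. 72] [cite: Bloch1972Semiregularity, Remark (7.5)] -/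
theorem cmHodgeHypothesisAt_of_weilLinePencilsOver_of_door_of_family (h₂₂ : andre1996_cmHodgeClasses_weilLinePencils_over)
    (hT : LocalVariationalHodgeFor 𝒪) (Y : ℕ → AbelianVariety ℂ) (hY : ∀ p, 0 < (Y p).dim ∧ (Y p).dim ∣ p)
    (hHC : ∀ (p : ℕ) (X : AbelianVariety ℂ) (N : ℕ), X.IsIsogenous ((Y p).powSucc N) → HodgeConjectureFor X.dim X.X)
    (hone : ∀ n p : ℕ, 2 ≤ p → p + 2 ≤ n → OneTensorWeilHodgeClassCarriersAt 𝒪 (Y p) n p) (B : AbelianVariety ℂ) : CMHodgeHypothesisAt B := by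
  intro hB hCM
  refine (hodgeConjectureFor_iff_of_isSmoothProjective nonempty_hodgeModel_holds hB).2 ?_
  intro p c hc hpp
  by_cases hp : p ≤ 1
  · exact (mem_algebraicClasses_and_divisorClassesSpan_of_offMidRange hB (Or.inl hp) c hc hpp).1
  refine (Submodule.span_le.mpr ?_) (h₂₂ (Y p) (hY p).1 (hHC p) B hB hCM p (by omega) (hY p).2 c hc hpp)
  rintro _ ⟨B', g, η', R', e₀', e', a', w, 𝒳, S, f, hB', -, -, -, -, hw, -, hf, rfl⟩
  have hw_alg : w ∈ algebraicClasses B'.X p := by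
    by_cases hw0 : w = 0
    · rw [hw0]; exact zero_mem _
    have h2 : 2 ≤ p := by omega
    have h4 : p + 2 ≤ B'.dim := by
      have h1 : 2 * p * 1 ≤ 2 * p * e₀' := Nat.mul_le_mul_left _ hB'.e₀_pos
      rw [hB'.dim_eq]
      omega
    exact weilClassesField_le_algebraicClasses_of_isWeilLineAnchoredPencilFor_of_door_of_oneCarried hT hB' hw0 hf
      (fun X θ hθ A₀ e'' N ψ₀ hd hiso ↦ hone B'.dim p h2 h4 X θ hθ A₀ e'' N ψ₀ hd hiso) hw
  exact map_mem_algebraicClasses_of_abelianVariety hB B' g.hom.hom.hom hw_alg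

/-- **`HC_CM` with the anchors UNCONDITIONALLY supplied: `dim (Y p) ≤ 3` for every `p`.** [cite: MoonenZarhin1999LowDim, Thm. 0.1 (4)]
[cite: Andre1996Motifs, §6.3 Lemmes 6.3.2–6.3.3 and proof (pp. 32–33)] -/
theorem cmHodgeHypothesisAt_of_weilLinePencilsOver_of_door_of_family_of_dim_le_three (h₂₂ : andre1996_cmHodgeClasses_weilLinePencils_over)
    (hT : LocalVariationalHodgeFor 𝒪) (Y : ℕ → AbelianVariety ℂ) (hY : ∀ p, 0 < (Y p).dim ∧ (Y p).dim ∣ p ∧ (Y p).dim ≤ 3)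
    (hone : ∀ n p : ℕ, 2 ≤ p → p + 2 ≤ n → OneTensorWeilHodgeClassCarriersAt 𝒪 (Y p) n p) (B : AbelianVariety ℂ) : CMHodgeHypothesisAt B :=
  cmHodgeHypothesisAt_of_weilLinePencilsOver_of_door_of_family h₂₂ hT Y (fun p ↦ ⟨(hY p).1, (hY p).2.1⟩)
    (fun p ↦ hodgeConjectureFor_of_isIsogenous_powSucc_of_dim_le_three (hY p).1 (hY p).2.2) hone B

/-- **`HC_AV` with `HC_CM` IDLE, from CM-algebraic carriers and one carried Weil class per tensor structure over a family of prescribed anchors**: Lemme 6.3.1 ∧ the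
prescribed-fibre CM LINE fact ∧ the door for `𝒪` ∧ CM-algebraic carriers (`2 ≤ p`, `2p + 4 ≤ n`) ∧ anchors `Y p` (`0 < dim (Y p) ∣ p`, powers satisfying HC) ∧ the
guarded per-cell node over `Y p` ⟹ `∀ A, HodgeConjectureFor A.dim A.X`. [cite: Andre1996Motifs, §6.3 Lemmes 6.3.1–6.3.3 (pp. 31–33)] [cite: Bloch1972Semiregularity, Remark (7.5)] -/
theorem forall_hodgeConjectureFor_of_andre1996_of_weilLinePencilsOver_of_door_of_cmAlgebraic_of_family (h₂₁ : andre1996_cmAnchoredPencil)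
    (h₂₂ : andre1996_cmHodgeClasses_weilLinePencils_over) (hT : LocalVariationalHodgeFor 𝒪)
    (hcm : ∀ n p : ℕ, 2 ≤ p → 2 * p + 4 ≤ n → AnchoredCarrierAt 𝒪 n p
      (fun X θ ↦ (∃ A₀ : AbelianVariety ℂ, A₀.dim = n ∧ IsOfCMType A₀ ∧ Nonempty (A₀.X ≅ X)) ∧ IsPolarizationClass n X θ)
      (fun X _ ↦ (algebraicClasses X p : Set (complexBetti X (2 * p)))))
    (Y : ℕ → AbelianVariety ℂ) (hY : ∀ p, 0 < (Y p).dim ∧ (Y p).dim ∣ p)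
    (hHC : ∀ (p : ℕ) (X : AbelianVariety ℂ) (N : ℕ), X.IsIsogenous ((Y p).powSucc N) → HodgeConjectureFor X.dim X.X)
    (hone : ∀ n p : ℕ, 2 ≤ p → p + 2 ≤ n → OneTensorWeilHodgeClassCarriersAt 𝒪 (Y p) n p) :
    ∀ A : AbelianVariety ℂ, HodgeConjectureFor A.dim A.X :=
  forall_hodgeConjectureFor_of_cmAnchoredPencil_of_cmHodge_of_cmAlgebraicCarrierAt h₂₁ hT
    (cmHodgeHypothesisAt_of_weilLinePencilsOver_of_door_of_family h₂₂ hT Y hY hHC hone) hcm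

/-- **Recovering the elliptic rows**: with the constant family `Y p := E₀` (`dim E₀ = 1 ∣ p`) the hypotheses are those of gen 61's
`cmHodgeHypothesisAt_of_weilLinePencils_of_door_of_oneTensorWeilHodgeClassCarriers`, granted the prescribed-fibre fact (which implies the elliptic one, §1).
[cite: Andre1996Motifs, §6.3 (pp. 31–33)] [cite: MoonenZarhin1999LowDim, Thm. 0.1 (4)] -/
theorem cmHodgeHypothesisAt_of_weilLinePencilsOver_of_door_of_oneTensorWeilHodgeClassCarriers (h₂₂ : andre1996_cmHodgeClasses_weilLinePencils_over)
    (hT : LocalVariationalHodgeFor 𝒪) {E₀ : AbelianVariety ℂ} (hE₀ : E₀.dim = 1) (hone : OneTensorWeilHodgeClassCarriers 𝒪 E₀) (B : AbelianVariety ℂ) :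
    CMHodgeHypothesisAt B :=
  cmHodgeHypothesisAt_of_weilLinePencilsOver_of_door_of_family_of_dim_le_three h₂₂ hT (fun _ ↦ E₀)
    (fun p ↦ ⟨by omega, by rw [hE₀]; exact one_dvd p, by omega⟩)
    (fun _ _ hp hn ↦ oneTensorWeilHodgeClassCarriersAt_of_oneTensorWeilHodgeClassCarriers hone hp hn) B

end Family

end Summit.HodgeConjecture.HodgeConjecture.Ring2.SemiregularRepresentatives

end
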